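import Mathlib.RingTheory.SimpleModule.Isotypic
import Mathlib.RingTheory.Idempotents
import Mathlib.LinearAlgebra.Dimension.Finrank
import Literature.RingTheory.SimpleModule.CentralIdempotentIsotypic
import Literature.RingTheory.SimpleModule.CentralCharacterIsotypicPrimitive
import HarnessLib

/-!
# Blocks of simple submodules and their transport along semilinear bijections

Generic bookkeeping for the «conjugate blocks» argument of [Liu2021] App. D (proof of Thm. D.6 (1)): the action of
`Aut(ℂ)` (there: of `Aut(ℚ̄_ℓ)` on `ℚ̄_ℓ ⊗ H¹_ét`) permutes the blocks of a semisimple algebra below a rational central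
idempotent and carries the block modules onto each other, preserving simplicity and dimension.

* §1 `exists_forall_smul_eq_self_of_isSimpleModule`: for a complete orthogonal family of CENTRAL idempotents `c_i` of a
  ring `R` and a simple submodule `S` of an `R`-module, exactly the situation of Lam (22.1): some `c_i` acts as the
  identity on `S` (the block of `S`).
* §1 `coe_isotypicComponent_eq_setOf_smul_eq_self`: over a semisimple ring the isotypic component of `S` is the
  `1`-eigenspace `{m | c • m = m}` of the centrally primitive block `c` of `S` (★ `CentralCharacterIsotypicPrimitive`,
  submodule form).
* §2 transport along a `σ`-SEMILINEAR equivalence `Θ : V ≃ₛₗ[σ] W` (`σ` a ring automorphism of `R`): `Θ` maps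
  `{v | x • v = v}` onto `{w | σ x • w = w}`, preserves simplicity of submodules (it induces an order isomorphism of the
  submodule lattices), and — when it is also `τ`-semilinear for an automorphism `τ` of a coefficient ring `L` in a tower
  `L → R` — preserves the `L`-dimension of submodules (Mathlib `lift_rank_eq_of_equiv_equiv`).

References: [Lam2001FirstCourse] §22 Prop. (22.1) (p. 326); [BourbakiAlgebreVIII2012] §4 no. 4, §5 no. 1 (isotypic
components and central idempotents); [BourbakiAlgebraI1989] Ch. II §1 no. 13 (semilinear maps and rank).
-/

namespace Literature.RingTheory.SimpleModule

open Function Module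

/-! ## §1 The block of a simple submodule -/

section Block

variable {R : Type*} [Ring R] {M : Type*} [AddCommGroup M] [Module R M]

/-- **The block of a simple submodule.**  If `c_i` is a complete orthogonal family of central idempotents of `R`
(`Σ c_i = 1`) and `S ≤ M` is a simple submodule, then some `c_i` acts as the identity on `S`: for `x₀ ≠ 0` in `S` some
`c_i x₀ ≠ 0`, and the `R`-linear idempotent endomorphism `c_i • ·` of the simple `S` is then injective, hence the identity.
[cite: Lam2001FirstCourse, §22 Prop. (22.1) and (22.2), p. 326] [cite: BourbakiAlgebreVIII2012, §5 no. 1] -/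
theorem exists_forall_smul_eq_self_of_isSimpleModule {I : Type*} [Fintype I] {c : I → R}
    (hco : CompleteOrthogonalIdempotents c) (hcen : ∀ (i : I) (a : R), c i * a = a * c i)
    (S : Submodule R M) [IsSimpleModule R S] : ∃ i, ∀ x ∈ S, c i • x = x := by
  classical
  haveI := IsSimpleModule.nontrivial R S
  obtain ⟨x₀, hx₀⟩ := exists_ne (0 : S)
  have hsum : ∑ i, c i • (x₀ : M) = x₀ := by rw [← Finset.sum_smul, hco.complete, one_smul]
  have hex : ∃ i, c i • (x₀ : M) ≠ 0 := by
    by_contra h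
    push Not at h
    apply hx₀
    apply Subtype.ext
    change (x₀ : M) = 0
    rw [← hsum]
    exact Finset.sum_eq_zero fun i _ => h i
  obtain ⟨i, hi⟩ := hex
  refine ⟨i, ?_⟩
  obtain ⟨f, hf⟩ := exists_linearMap_apply_eq_smul (M := M) (fun r => (hcen i r).symm)
  have hfS : ∀ x : S, f.domRestrict S x ∈ S := fun x => by
    rw [LinearMap.domRestrict_apply, hf]
    exact S.smul_mem _ x.2
  have hg : ∀ x : S, (((f.domRestrict S).codRestrict S hfS x : S) : M) = c i • (x : M) := fun x => by
    rw [LinearMap.codRestrict_apply, LinearMap.domRestrict_apply, hf]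
  rcases ((f.domRestrict S).codRestrict S hfS).injective_or_eq_zero with hinj | h0
  · intro x hx
    have hgg : (f.domRestrict S).codRestrict S hfS ((f.domRestrict S).codRestrict S hfS ⟨x, hx⟩) =
        (f.domRestrict S).codRestrict S hfS ⟨x, hx⟩ := by
      apply Subtype.ext
      rw [hg, hg, ← mul_smul, (hco.idem i).eq]
    have h := congrArg Subtype.val (hinj hgg)
    rwa [hg] at h
  · exfalso
    apply hi
    have h := congrArg Subtype.val (LinearMap.congr_fun h0 x₀)
    rwa [hg] at h

/-- **The isotypic component of a simple submodule is its block**, submodule form of ★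
`mem_isotypicComponent_iff_smul_eq_self_of_isCentrallyPrimitive`: over a semisimple ring, if the centrally primitive
idempotent `ε` fixes the simple submodule `S ≤ M`, then `isotypicComponent R M S = {m | ε • m = m}` as subsets of `M`.
[cite: Lam2001FirstCourse, §3 Lemma (3.8) (p. 35) and §22 Prop. (22.1) (p. 326)] [cite: BourbakiAlgebreVIII2012, §5 no. 1] -/
theorem coe_isotypicComponent_eq_setOf_smul_eq_self [IsSemisimpleRing R] {ε : R}
    (hε : Literature.RingTheory.Idempotents.IsCentrallyPrimitive ε) (S : Submodule R M) [IsSimpleModule R S]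
    (hS : ∀ x ∈ S, ε • x = x) :
    (isotypicComponent R M S : Set M) = {m | ε • m = m} := by
  ext m
  exact mem_isotypicComponent_iff_smul_eq_self_of_isCentrallyPrimitive M (S := S) hε
    (fun x => Subtype.ext (by rw [Submodule.coe_smul]; exact hS x x.2)) m

end Block

/-! ## §2 Transport along a semilinear equivalence -/

section Transport

variable {R : Type*} [Ring R] {σ σ' : R →+* R} [RingHomInvPair σ σ'] [RingHomInvPair σ' σ]
  {V : Type*} {W : Type*} [AddCommGroup V] [Module R V] [AddCommGroup W] [Module R W]

/-- A `σ`-semilinear equivalence carries the `1`-eigenspace of `x ∈ R` onto the `1`-eigenspace of `σ x`.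
[cite: BourbakiAlgebraI1989, Ch. II §1 no. 13] -/
theorem image_setOf_smul_eq_self (Θ : V ≃ₛₗ[σ] W) (x : R) :
    (Θ : V → W) '' {v | x • v = v} = {w | σ x • w = w} := by
  ext w
  constructor
  · rintro ⟨v, hv, rfl⟩
    have hv' : x • v = v := hv
    change σ x • Θ v = Θ v
    rw [← Θ.map_smulₛₗ, hv']
  · intro hw
    have hw' : σ x • w = w := hw
    refine ⟨Θ.symm w, ?_, Θ.apply_symm_apply w⟩
    change x • Θ.symm w = Θ.symm w
    apply Θ.injective
    rw [Θ.map_smulₛₗ, Θ.apply_symm_apply, hw']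

/-- A semilinear equivalence preserves simplicity of submodules (it induces an order isomorphism of the submodule
lattices, Mathlib `Submodule.orderIsoMapComap`, and simplicity of `p` is `IsAtom p`). [cite: BourbakiAlgebreVIII2012, §4 no. 4] -/
theorem isSimpleModule_map_iff (Θ : V ≃ₛₗ[σ] W) (p : Submodule R V) :
    IsSimpleModule R ↥(p.map (Θ : V →ₛₗ[σ] W)) ↔ IsSimpleModule R ↥p := by
  rw [isSimpleModule_iff_isAtom, isSimpleModule_iff_isAtom]
  exact (Submodule.orderIsoMapComap Θ).isAtom_iff p

/-- The image of a submodule under a semilinear equivalence, as a set. [cite: BourbakiAlgebraI1989, Ch. II §1 no. 13] -/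
theorem coe_map_semilinearEquiv (Θ : V ≃ₛₗ[σ] W) (p : Submodule R V) :
    (p.map (Θ : V →ₛₗ[σ] W) : Set W) = (Θ : V → W) '' p := by
  ext w
  simp only [Submodule.map_coe, Set.mem_image, SetLike.mem_coe]
  rfl

/-- **Semilinear bijections preserve dimension over a coefficient ring.**  In a tower `L → R` (`V`, `W` are `R`-modules
and `L`-modules compatibly), a `σ`-semilinear equivalence `Θ : V ≃ W` which is also `τ`-semilinear for a ring
automorphism `τ` of `L` carries every `R`-submodule `p` onto an `R`-submodule of the same `L`-rank (Mathlib
`lift_rank_eq_of_equiv_equiv` applied to `p ≃+ Θ(p)`). [cite: BourbakiAlgebraI1989, Ch. II §1 no. 13 and §7 no. 2] -/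
theorem finrank_map_eq_of_semilinear {L : Type*} [CommSemiring L] [Module L V] [Module L W]
    [SMul L R] [IsScalarTower L R V] [IsScalarTower L R W]
    (τ : L ≃+* L) (Θ : V ≃ₛₗ[σ] W) (hΘ : ∀ (z : L) (v : V), Θ (z • v) = τ z • Θ v) (p : Submodule R V) :
    Module.finrank L ↥(p.map (Θ : V →ₛₗ[σ] W)) = Module.finrank L ↥p := by
  let j : ↥p ≃+ ↥(p.map (Θ : V →ₛₗ[σ] W)) :=
    (Submodule.equivMapOfInjective (Θ : V →ₛₗ[σ] W) Θ.injective p).toAddEquiv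
  have hj : ∀ (z : L) (x : ↥p), j (z • x) = τ z • j x := by
    intro z x
    apply Subtype.ext
    change ((Submodule.equivMapOfInjective (Θ : V →ₛₗ[σ] W) Θ.injective p (z • x) : ↥(p.map (Θ : V →ₛₗ[σ] W))) : W) =
      τ z • ((Submodule.equivMapOfInjective (Θ : V →ₛₗ[σ] W) Θ.injective p x : ↥(p.map (Θ : V →ₛₗ[σ] W))) : W)
    rw [Submodule.coe_equivMapOfInjective_apply, Submodule.coe_equivMapOfInjective_apply, Submodule.coe_smul_of_tower]
    exact hΘ z x
  have h := lift_rank_eq_of_equiv_equiv (R := L) (R' := L) τ j τ.bijective hj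
  have h' := congrArg Cardinal.toNat h
  rw [Cardinal.toNat_lift, Cardinal.toNat_lift] at h'
  exact h'.symm

end Transport

end Literature.RingTheory.SimpleModule
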